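import Summits.Ventures.HodgeRepro2.T5FinitePlaceNegOneSum

/-!
# `−1` is a sum of four squares in every dyadic completion, so `(U)` holds on `F_v(√−1)` at every place
(cell pub-hodge-repro2, seat p3)

Tier-5 N2 support, rows N2.2.2 / N2.8.1 of route/T5-N2-route-3.md. File 148 reduced `(U)` at every finite
non-split place to «`−1` is a sum of two norms from `E_w`». For `E_w = F_v(√−1)` (`−θ` a `v`-adic square) a norm is a
sum of two squares, so the input is «`−1` is a sum of four squares in `F_v`»:

* `isSquare_neg_seven_of_not_isUnit_two`: at a dyadic place `−7 = 1 + 4·(−2)` is a square of `O_{F_v}` (seat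
  p4's Hensel square; file 145's argument for any number field);
* `neg_one_eq_sum_four_sq`: `−1 = 7 / (√−7)² = (1/t)² + (1/t)² + (1/t)² + (2/t)²` with `t² = −7`;
* **`isSumTwoNorms_neg_one_of_isSquare_neg`**: if `−θ = r²` in `F_v` then `−1 = N(x₁) + N(x₂)` with
  `x₁ = t⁻¹ + t⁻¹ r⁻¹ √θ`, `x₂ = t⁻¹ + 2 t⁻¹ r⁻¹ √θ` (`N(a + b√θ) = a² − θ b² = a² + (r b)²`);
* **`binaryUniversal_of_isSquare_neg`**: `(U)` on `E_w` at any finite non-split DYADIC place with `−θ` a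
  `v`-adic square — with file 143 this is `(U)` at EVERY finite non-split place of a CM field `K = K⁺(√−1)`
  (`θ = −1`), the wild places included.

Mathlib + this seat's files 141–148 and seat p4's chain through them only; no display; no device. §8(d): uses an
L-value-free non-vanishing device: NO.
-/

namespace Summit.Ventures.HodgeRepro2.T5FinitePlaceFourSquares

open IsDedekindDomain IsDedekindDomain.HeightOneSpectrum NumberField Module
open Summit.Ventures.HodgeRepro2.T5FinitePlaceTensorEquiv Summit.Ventures.HodgeRepro2.T5FinitePlaceStar
  Summit.Ventures.HodgeRepro2.T5HermitianDetClass Summit.Ventures.HodgeRepro2.T5HermitianClassify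
  Summit.Ventures.HodgeRepro2.T5AdicCompletionNormGroup Summit.Ventures.HodgeRepro2.T5LocalNormIndex
  Summit.Ventures.HodgeRepro2.T5FinitePlaceNormIndex Summit.Ventures.HodgeRepro2.T5FinitePlaceSumTwoNorms
  Summit.Ventures.HodgeRepro2.T5FinitePlaceBinaryUniversal Summit.Ventures.HodgeRepro2.T5FinitePlaceBinaryUniversalInert
  Summit.Ventures.HodgeRepro2.T5FinitePlaceNegOneNorm Summit.Ventures.HodgeRepro2.T5FinitePlaceNegOneSum

section Dyadic

variable {F : Type*} [Field F] [NumberField F] (v : HeightOneSpectrum (𝓞 F))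

/-- At a dyadic place (`2` not a unit of `O_{F_v}`), `−2` lies in the maximal ideal. -/
theorem neg_two_mem_maximalIdeal (h2 : ¬ IsUnit (2 : adicCompletionIntegers F v)) :
    (-2 : adicCompletionIntegers F v) ∈ IsLocalRing.maximalIdeal (adicCompletionIntegers F v) := by
  rw [T5AdicCompletionResidueField.mem_maximalIdeal_iff]
  rw [adicCompletionIntegers.isUnit_iff_valued_eq_one] at h2
  have hle : Valued.v ((2 : adicCompletionIntegers F v) : v.adicCompletion F) ≤ 1 :=
    (mem_adicCompletionIntegers _ _ _).1 (2 : adicCompletionIntegers F v).2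
  rw [show ((-2 : adicCompletionIntegers F v) : v.adicCompletion F) =
      -((2 : adicCompletionIntegers F v) : v.adicCompletion F) from rfl, Valuation.map_neg]
  exact lt_of_le_of_ne hle h2

/-- **`−7` is a square in every dyadic completion** (`−7 = 1 + 4·(−2)`, seat p4's Hensel square). -/
theorem isSquare_neg_seven_of_not_isUnit_two (h2 : ¬ IsUnit (2 : adicCompletionIntegers F v)) :
    IsSquare (-7 : v.adicCompletion F) := by
  obtain ⟨a, -, ha⟩ := T5NormGroupOpen.exists_sq_eq_of_sub_one_mem_four_mul v
    (-7 : adicCompletionIntegers F v) ⟨-2, neg_two_mem_maximalIdeal v h2, by norm_num⟩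
  refine ⟨((1 + 2 * a : adicCompletionIntegers F v) : v.adicCompletion F), ?_⟩
  have h := congrArg Subtype.val ha
  push_cast at h ⊢
  rw [← sq, h]
  norm_cast

/-- **`−1` is a sum of four squares in every dyadic completion:** `−1 = (1/t)² + (1/t)² + (1/t)² + (2/t)²` with
`t² = −7`. -/
theorem neg_one_eq_sum_four_sq (h2 : ¬ IsUnit (2 : adicCompletionIntegers F v)) :
    ∃ a b c d : v.adicCompletion F, a ^ 2 + b ^ 2 + c ^ 2 + d ^ 2 = -1 := by
  haveI : CharZero (v.adicCompletion F) :=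
    charZero_of_injective_algebraMap (algebraMap ℚ (v.adicCompletion F)).injective
  obtain ⟨t, ht⟩ := isSquare_neg_seven_of_not_isUnit_two v h2
  have ht0 : t ≠ 0 := by
    rintro rfl
    rw [mul_zero] at ht
    exact (by norm_num : (-7 : v.adicCompletion F) ≠ 0) ht
  refine ⟨t⁻¹, t⁻¹, t⁻¹, 2 * t⁻¹, ?_⟩
  have : t ^ 2 = -7 := by rw [sq, ← ht]
  field_simp
  linear_combination this

end Dyadic

section Norms

variable {F E : Type*} [Field F] [NumberField F] [Field E] [NumberField E] [Algebra F E]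
  [Algebra.IsQuadraticExtension F E]
variable (v : HeightOneSpectrum (𝓞 F)) (w : HeightOneSpectrum (𝓞 E)) [w.asIdeal.LiesOver v.asIdeal]
variable {s : E} {θ : F}
variable (hs : s ^ 2 = algebraMap F E θ) (hspan : Submodule.span F {(1 : E), s} = ⊤)
  (hsq : ¬ IsSquare (algebraMap F (v.adicCompletion F) θ)) (c : E ≃ₐ[F] E) (hc : c s = -s)

/-- The norm of `a + b √θ` in `E_w`, with `a, b ∈ F_v`: `star (a + b s) · (a + b s) = a² − θ b²`. -/
theorem star_mul_self_add (a b : v.adicCompletion F) :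
    letI := localStarRing v w hs hspan hsq c hc
    star (algebraMap (v.adicCompletion F) (w.adicCompletion E) a +
        algebraMap (v.adicCompletion F) (w.adicCompletion E) b * algebraMap E (w.adicCompletion E) s) *
      (algebraMap (v.adicCompletion F) (w.adicCompletion E) a +
        algebraMap (v.adicCompletion F) (w.adicCompletion E) b * algebraMap E (w.adicCompletion E) s) =
      algebraMap (v.adicCompletion F) (w.adicCompletion E) (a ^ 2 - algebraMap F (v.adicCompletion F) θ * b ^ 2) := by
  letI := localStarRing v w hs hspan hsq c hc
  rw [star_add, star_mul, star_algebraMap_left' v w hs hspan hsq c hc, star_algebraMap_left' v w hs hspan hsq c hc,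
    star_algebraMap_s v w hs hspan hsq c hc]
  have hs2 : algebraMap E (w.adicCompletion E) s * algebraMap E (w.adicCompletion E) s =
      algebraMap (v.adicCompletion F) (w.adicCompletion E) (algebraMap F (v.adicCompletion F) θ) := by
    rw [← map_mul, ← sq, hs, ← IsScalarTower.algebraMap_apply, IsScalarTower.algebraMap_apply F (v.adicCompletion F)
      (w.adicCompletion E)]
  rw [map_sub, map_mul, map_pow, map_pow]
  linear_combination (-(algebraMap (v.adicCompletion F) (w.adicCompletion E) b) ^ 2) * hs2

/-- **`−1` is a sum of two norms from `E_w = F_v(√−1)`** (`−θ` a `v`-adic square) at a dyadic place: with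
`t² = −7` and `r² = −θ`, `−1 = N(t⁻¹ + t⁻¹ r⁻¹ √θ) + N(t⁻¹ + 2 t⁻¹ r⁻¹ √θ)`. -/
theorem isSumTwoNorms_neg_one_of_isSquare_neg (h2 : ¬ IsUnit (2 : adicCompletionIntegers F v))
    (hneg : IsSquare (-(algebraMap F (v.adicCompletion F) θ))) :
    letI := localStarRing v w hs hspan hsq c hc
    ∃ x y : w.adicCompletion E, star x * x + star y * y = -1 := by
  letI := localStarRing v w hs hspan hsq c hc
  haveI : CharZero (v.adicCompletion F) :=
    charZero_of_injective_algebraMap (algebraMap ℚ (v.adicCompletion F)).injective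
  obtain ⟨r, hr⟩ := hneg
  obtain ⟨a, b, c', d, habcd⟩ := neg_one_eq_sum_four_sq v h2
  have hr0 : r ≠ 0 := by
    rintro rfl
    rw [mul_zero, neg_eq_zero, map_eq_zero] at hr
    exact hsq (by rw [hr, map_zero]; exact ⟨0, by simp⟩)
  refine ⟨algebraMap (v.adicCompletion F) (w.adicCompletion E) a +
    algebraMap (v.adicCompletion F) (w.adicCompletion E) (b / r) * algebraMap E (w.adicCompletion E) s,
    algebraMap (v.adicCompletion F) (w.adicCompletion E) c' +
    algebraMap (v.adicCompletion F) (w.adicCompletion E) (d / r) * algebraMap E (w.adicCompletion E) s, ?_⟩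
  rw [star_mul_self_add v w hs hspan hsq c hc, star_mul_self_add v w hs hspan hsq c hc,
    ← map_add (algebraMap (v.adicCompletion F) (w.adicCompletion E)),
    ← map_one (algebraMap (v.adicCompletion F) (w.adicCompletion E)),
    ← map_neg (algebraMap (v.adicCompletion F) (w.adicCompletion E))]
  congr 1
  have hθ : algebraMap F (v.adicCompletion F) θ = -(r * r) := by rw [← hr, neg_neg]
  rw [hθ, ← habcd]
  field_simp
  ring

/-- **`(U)` on `E_w = F_v(√−1)` at any dyadic non-split place:** with file 143 this is `(U)` at EVERY finite
non-split place of a CM field `K = K⁺(√−1)`, the wild places included. -/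
theorem binaryUniversal_of_isSquare_neg (h2 : ¬ IsUnit (2 : adicCompletionIntegers F v))
    (hneg : IsSquare (-(algebraMap F (v.adicCompletion F) θ))) :
    letI := localStarRing v w hs hspan hsq c hc
    BinaryUniversal (w.adicCompletion E) :=
  binaryUniversal_of_neg_one_sum v w hs hspan hsq c hc
    (isSumTwoNorms_neg_one_of_isSquare_neg v w hs hspan hsq c hc h2 hneg)

/-- `(U)` on `E_w` at EVERY finite non-split place when `−θ` is a square in `F_v` whenever the place is dyadic —
in particular for `θ = −1` (`K = K⁺(√−1)`): file 143 at the non-dyadic places, the four-squares argument at the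
dyadic ones. -/
theorem binaryUniversal_of_isSquare_neg_of_not_isUnit
    (hneg : ¬ IsUnit (2 : adicCompletionIntegers F v) → IsSquare (-(algebraMap F (v.adicCompletion F) θ))) :
    letI := localStarRing v w hs hspan hsq c hc
    BinaryUniversal (w.adicCompletion E) := by
  by_cases h2 : IsUnit (2 : adicCompletionIntegers F v)
  · exact binaryUniversal v w hs hspan hsq c hc h2
  · exact binaryUniversal_of_isSquare_neg v w hs hspan hsq c hc h2 (hneg h2)

end Norms

end Summit.Ventures.HodgeRepro2.T5FinitePlaceFourSquares
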